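import Mathlib
import Summits.CriticalPhenomena.CardyFormulaZ2.Theorems.CardySelfRefinementDefs
import Summits.CriticalPhenomena.CardyFormulaZ2.Theorems.CardySelfRefinementRussoDriftPolynomial
import Summits.CriticalPhenomena.CardyFormulaZ2.Theorems.CardySelfRefinementTrivialSectorRateStubSixArmDecayClusters
import Literature.Probability.Percolation.PivotalCell
import Literature.Probability.LatticeModels.ProdBernoulliIndependence
import HarnessLib

/-!
# Far-field factorisation of the six-arm sector term (line `far-field-is-a-quarter-turn`, crux
`TrivialSectorRate`, stmt-CriticalPhenomena-10266), helper of stub `stub_sixArmSectorMass`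

`Six k m F η q u R = M_k(q)(sixArmThreeClustersAt (k•u) (k+1) R ∩ Rel u R)`.  The six-arm event of
the annulus `k•u + A_{k+1,R'}` is a cylinder over the pairs of sites of that annulus
(`determinedBy_sixArmThreeClustersAt`), the relevance `Rel u R` of the `R`-box is a cylinder over
the edges OFF the box (`determinedBy_Rel_compl`), and for `R' + k ≤ R` the coins of `M_k` read by
the two edge sets are disjoint (`disjoint_coinsOf_of_far`: two fine edges reading a common coin have
the same coarse base, hence lie within sup-distance `k` of each other) — so under the product coin
measure the two pulled-back events are independent (`prodBernoulli_real_inter_of_determinedBy`):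

* `real_sixArmThreeClustersAt_inter_Rel_eq_mul` — for `η ≠ 0`, `0 < k`, `R' + k ≤ R`:
  `M_k(q)(sixArm (k•u) r R' ∩ Rel u R) = M_k(q)(sixArm (k•u) r R') · M_k(q)(Rel u R)`;
* **`Six_le_real_sixArm_mul_real_Rel`** (registered helper): for `η ≠ 0`, `0 < k`,
  `k + 1 ≤ R'`, `R' + k ≤ R`:
  `Six k m F η q u R ≤ M_k(q)(sixArmThreeClustersAt (k•u) (k+1) R') · M_k(q)(Rel k m F η u R)`
  (shrink the six-arm annulus from `R` to `R'`, `mem_sixArmThreeClustersAt_mono`, then factorise).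

This is the hypothesis (HF) of the summation theorem `sixArmSectorMass_of_boundaryRelevance`.
-/

noncomputable section

namespace Summit.CriticalPhenomena.CardyFormulaZ2.Theorems.CardySelfRefinement.FarField

open scoped Topology
open Filter Set MeasureTheory
open Literature.Probability.LatticeModels Literature.Probability.Percolation
open Literature.Probability.Percolation.QuadCrossing
open Summit.CriticalPhenomena.CardyFormulaZ2.Theses.CardySelfRefinement

/-! ## Two locality facts (local copies of `…StubSixArmSectorMassLocality`) -/

/-- `Aloc m F η = {ω | ω ∩ window ∈ A}` is determined by the window (local copy of
`determinedBy_Aloc_window`). -/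
private theorem determinedBy_Aloc_window_aux (m : ℕ) (F : Fin m → Quad (univ : Set ℂ)) (η : ℝ) :
    DeterminedBy (Aloc m F η) (window m F η) := by
  rw [determinedBy_iff]
  intro ω ω' h
  simp only [Aloc, Set.mem_setOf_eq, h]

/-- Set-pivotality on `C` is decided off `C` (local copy of `determinedBy_setOf_isPivotalOn_compl`). -/
private theorem determinedBy_setOf_isPivotalOn_compl_aux {ι : Type*} (A : Set (Set ι)) (C : Set ι) :
    DeterminedBy {ω | IsPivotalOn A C ω} Cᶜ := by
  rw [determinedBy_iff]
  suffices key : ∀ ω₁ ω₂ : Set ι, ω₁ ∩ Cᶜ = ω₂ ∩ Cᶜ → IsPivotalOn A C ω₁ → IsPivotalOn A C ω₂ from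
    fun ω₁ ω₂ h => ⟨key ω₁ ω₂ h, key ω₂ ω₁ h.symm⟩
  rintro ω₁ ω₂ h ⟨ω', hagree, hflip⟩
  have h12 : ∀ i, i ∉ C → (i ∈ ω₁ ↔ i ∈ ω₂) := fun i hi =>
    ⟨fun h1 => ((Set.ext_iff.1 h i).1 ⟨h1, hi⟩).1, fun h2 => ((Set.ext_iff.1 h i).2 ⟨h2, hi⟩).1⟩
  by_cases hA : (ω₂ ∈ A ↔ ω₁ ∈ A)
  · exact ⟨ω', fun i hi => (hagree i hi).trans (h12 i hi), fun hiff => hflip (hiff.trans hA)⟩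
  · exact ⟨ω₁, fun i hi => h12 i hi, fun hiff => hA hiff.symm⟩

/-! ## Coin windows -/

/-- `coinWindow` is monotone in the edge set. -/
theorem coinWindow_mono (k : ℕ) {W W' : Set (Sym2 (Site 2))} (h : W ⊆ W') :
    coinWindow k W ⊆ coinWindow k W' := by
  intro i hi
  obtain ⟨vd, hvd, hi⟩ := Set.mem_iUnion₂.1 hi
  exact Set.mem_biUnion (show vd ∈ edgeOf ⁻¹' W' from h hvd) hi

/-- **The pull-back through `cfg k` of an event determined by the edge set `W` is determined by the
coins read through `W`.** -/
theorem determinedBy_preimage_cfg (k : ℕ) {B : Set (BondConfig (Site 2))} {W : Set (Sym2 (Site 2))}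
    (hB : DeterminedBy B W) : DeterminedBy ((cfg k) ⁻¹' B) (coinWindow k W) := by
  rw [determinedBy_iff] at hB ⊢
  intro S S' hSS'
  have h : ∀ i ∈ coinWindow k W, (i ∈ S ↔ i ∈ S') := fun i hi =>
    ⟨fun hS => ((Set.ext_iff.1 hSS' i).1 ⟨hS, hi⟩).1, fun hS' => ((Set.ext_iff.1 hSS' i).2 ⟨hS', hi⟩).1⟩
  exact hB _ _ (cfg_inter_eq_of_agree k h)

/-- Two fine edges reading a common coin have the same direction and the same coarse base. -/
theorem tb_eq_of_mem_coinsOf (k : ℕ) {vd vd' : Site 2 × Fin 2} {i : Coin} (hi : i ∈ coinsOf k vd)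
    (hi' : i ∈ coinsOf k vd') : vd.2 = vd'.2 ∧ tb k vd = tb k vd' := by
  obtain ⟨v, d⟩ := vd
  obtain ⟨v', d'⟩ := vd'
  simp only [coinsOf, Set.mem_insert_iff, Set.mem_singleton_iff] at hi hi'
  rcases hi with rfl | rfl | rfl <;> rcases hi' with h | h | h <;>
    simp only [Prod.mk.injEq, Fin.reduceEq, and_false, and_true] at h
  · obtain ⟨rfl, rfl⟩ := h; exact ⟨rfl, rfl⟩
  · exact ⟨h.2, h.1⟩
  · exact ⟨h.2, h.1⟩

/-- Sites with the same coarse base are within sup-distance `k − 1` of each other. -/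
theorem abs_sub_lt_of_tb_eq {k : ℕ} (hk : 0 < k) {vd vd' : Site 2 × Fin 2} (h : tb k vd = tb k vd')
    (j : Fin 2) : vd.1 j - vd'.1 j < k ∧ vd'.1 j - vd.1 j < k := by
  have hk0 : (0 : ℤ) < k := by exact_mod_cast hk
  have hq : vd.1 j / (k : ℤ) = vd'.1 j / (k : ℤ) := congrFun h j
  have h1 := Int.mul_ediv_add_emod (vd.1 j) k
  have h2 := Int.mul_ediv_add_emod (vd'.1 j) k
  have h3 := Int.emod_nonneg (vd.1 j) hk0.ne'
  have h4 := Int.emod_lt_of_pos (vd.1 j) hk0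
  have h5 := Int.emod_nonneg (vd'.1 j) hk0.ne'
  have h6 := Int.emod_lt_of_pos (vd'.1 j) hk0
  rw [hq] at h1
  constructor <;> linarith

/-- `dirVec d j ∈ {0, 1}` as an inequality pair. -/
theorem dirVec_apply_mem (d j : Fin 2) : 0 ≤ dirVec d j ∧ dirVec d j ≤ 1 := by
  fin_cases d <;> fin_cases j <;> simp [dirVec]

/-- `edgeOf vd` is a nearest-neighbour edge of `ℤ²` (local copy of `edgeOf_mem_edgeSet'` of the
gradient-comparability files, not imported here). -/
private theorem edgeOf_mem_edgeSet_aux (vd : Site 2 × Fin 2) : edgeOf vd ∈ (zdGraph 2).edgeSet := by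
  rw [SimpleGraph.mem_edgeSet]
  exact (zdGraph_adj_iff _ _).2 ⟨vd.2, Or.inl (by simp only [dirVec]; rw [dirVec_eq_single])⟩

/-- **Coins separate far edges**: if every endpoint of `edgeOf vd` lies in the `R'`-box about `c`
and `edgeOf vd'` is not an edge of the `R`-box about `c`, with `R' + k ≤ R`, then `vd` and `vd'`
read disjoint coin sets (a common coin forces a common coarse base, hence sup-distance `< k`). -/
theorem disjoint_coinsOf_of_far {k : ℕ} (hk : 0 < k) {c : Site 2} {R' R : ℕ} (hR : R' + k ≤ R)
    {vd vd' : Site 2 × Fin 2} (hin : ∀ w ∈ edgeOf vd, w - c ∈ box 2 R')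
    (hout : edgeOf vd' ∉ boxEdgesAt c R) : Disjoint (coinsOf k vd) (coinsOf k vd') := by
  rw [Set.disjoint_left]
  intro i hi hi'
  obtain ⟨hd, htb⟩ := tb_eq_of_mem_coinsOf k hi hi'
  apply hout
  refine ⟨edgeOf_mem_edgeSet_aux vd', fun w hw => ?_⟩
  have hv : vd.1 - c ∈ box 2 R' := hin vd.1 (Sym2.mem_mk_left _ _)
  rw [mem_box] at hv ⊢
  intro j
  obtain ⟨hlo, hhi⟩ := hv j
  obtain ⟨hlt1, hlt2⟩ := abs_sub_lt_of_tb_eq hk htb j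
  obtain ⟨hd0, hd1⟩ := dirVec_apply_mem vd'.2 j
  have hRR : ((R' : ℤ) + k ≤ R) := by exact_mod_cast hR
  simp only [Pi.sub_apply] at hlo hhi ⊢
  have hw' : w j = vd'.1 j ∨ w j = vd'.1 j + dirVec vd'.2 j := by
    rcases Sym2.mem_iff.1 hw with rfl | rfl
    · exact Or.inl rfl
    · exact Or.inr rfl
  rcases hw' with h | h <;> rw [h] <;> constructor <;> linarith

/-! ## The six-arm event is a cylinder over the annulus -/

/-- The translated annulus as a `Finset` image. -/
theorem image_add_sqAnnulus_eq_coe (c : Site 2) (r n : ℕ) :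
    ((· + c) '' sqAnnulus r n) = ↑((annulus 2 (r - 1) n).image (· + c)) := by
  rw [Finset.coe_image]
  rfl

/-- **`sixArmThreeClustersAt c r n` is determined by the pairs of sites of the annulus `c + A_{r,n}`**
(each `openConnIn` is, `PlanarDuality.determinedBy_openConnIn`). -/
theorem determinedBy_sixArmThreeClustersAt (c : Site 2) (r n : ℕ) :
    DeterminedBy (sixArmThreeClustersAt c r n)
      (↑((annulus 2 (r - 1) n).image (· + c)).sym2 : Set (Sym2 (Site 2))) := by
  have hS := image_add_sqAnnulus_eq_coe c r n
  have hconn : ∀ x y : Site 2, DeterminedBy (openConnIn ((· + c) '' sqAnnulus r n) x y)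
      (↑((annulus 2 (r - 1) n).image (· + c)).sym2 : Set (Sym2 (Site 2))) := by
    intro x y
    rw [hS]
    exact PlanarDuality.determinedBy_openConnIn _ x y
  rw [determinedBy_iff]
  intro ω ω' h
  have hc : ∀ x y : Site 2, ω ∈ openConnIn ((· + c) '' sqAnnulus r n) x y ↔
      ω' ∈ openConnIn ((· + c) '' sqAnnulus r n) x y :=
    fun x y => (determinedBy_iff _ _).1 (hconn x y) ω ω' h
  simp only [sixArmThreeClustersAt, Set.mem_setOf_eq, hc]

/-- The six-arm event is measurable. -/
theorem measurableSet_sixArmThreeClustersAt (c : Site 2) (r n : ℕ) :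
    MeasurableSet (sixArmThreeClustersAt c r n) :=
  (determinedBy_sixArmThreeClustersAt c r n).measurableSet_of_finset

/-- Endpoints of a pair of annulus sites lie in the `n`-box about `c`. -/
theorem sub_mem_box_of_mem_sym2_annulus {c : Site 2} {r n : ℕ} {e : Sym2 (Site 2)}
    (he : e ∈ (↑((annulus 2 (r - 1) n).image (· + c)).sym2 : Set (Sym2 (Site 2)))) :
    ∀ w ∈ e, w - c ∈ box 2 n := by
  intro w hw
  have hw' : w ∈ (annulus 2 (r - 1) n).image (· + c) := Finset.mem_sym2_iff.1 (Finset.mem_coe.1 he) w hw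
  obtain ⟨a, ha, rfl⟩ := Finset.mem_image.1 hw'
  simp only [annulus, Finset.mem_sdiff] at ha
  simpa using ha.1

/-! ## Relevance is a cylinder over the complement of the box and over the window -/

/-- `Rel u R` is determined by the edges off the `R`-box. -/
theorem determinedBy_Rel_compl (k m : ℕ) (F : Fin m → Quad (univ : Set ℂ)) (η : ℝ) (u : Site 2)
    (R : ℕ) : DeterminedBy (Rel k m F η u R) (boxEdgesAt (ctr k u) R)ᶜ :=
  determinedBy_setOf_isPivotalOn_compl_aux _ _

/-- `Rel u R` is determined by the window. -/
theorem determinedBy_Rel_window (k m : ℕ) (F : Fin m → Quad (univ : Set ℂ)) (η : ℝ) (u : Site 2)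
    (R : ℕ) : DeterminedBy (Rel k m F η u R) (window m F η) :=
  (determinedBy_Aloc_window_aux m F η).isPivotalOn _

/-- `Rel u R` is measurable (`η ≠ 0`: the window is finite). -/
theorem measurableSet_Rel (k m : ℕ) (F : Fin m → Quad (univ : Set ℂ)) {η : ℝ} (hη : η ≠ 0)
    (u : Site 2) (R : ℕ) : MeasurableSet (Rel k m F η u R) := by
  have hfin := window_finite m F hη
  have h : DeterminedBy (Rel k m F η u R) (↑hfin.toFinset : Set (Sym2 (Site 2))) := by
    rw [Set.Finite.coe_toFinset]
    exact determinedBy_Rel_window k m F η u R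
  exact h.measurableSet_of_finset

/-! ## The product formula -/

/-- **Independence of the six-arm event inside the `R'`-box and the relevance of the `R`-box**
(`R' + k ≤ R`, `η ≠ 0`): under `M_k(q)` the two events multiply. -/
theorem real_sixArmThreeClustersAt_inter_Rel_eq_mul {k : ℕ} (hk : 0 < k) (m : ℕ)
    (F : Fin m → Quad (univ : Set ℂ)) {η : ℝ} (hη : η ≠ 0) (q : ℝ × ℝ) (u : Site 2) (r : ℕ)
    {R' R : ℕ} (hR : R' + k ≤ R) :
    (M k q.1 q.2).real (sixArmThreeClustersAt (ctr k u) r R' ∩ Rel k m F η u R) =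
      (M k q.1 q.2).real (sixArmThreeClustersAt (ctr k u) r R') *
        (M k q.1 q.2).real (Rel k m F η u R) := by
  classical
  set X := sixArmThreeClustersAt (ctr k u) r R' with hX
  set Y := Rel k m F η u R with hY
  have hXm : MeasurableSet X := measurableSet_sixArmThreeClustersAt _ _ _
  have hYm : MeasurableSet Y := measurableSet_Rel k m F hη u R
  -- pass to the coin space
  rw [map_measureReal_apply (measurable_cfg k) (hXm.inter hYm),
    map_measureReal_apply (measurable_cfg k) hXm, map_measureReal_apply (measurable_cfg k) hYm,
    Set.preimage_inter]
  -- the coin window of the annulus pairs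
  set W : Set (Sym2 (Site 2)) := ↑((annulus 2 (r - 1) R').image (· + ctr k u)).sym2 with hW
  have hWfin : W.Finite := Finset.finite_toSet _
  have hCWfin : (coinWindow k W).Finite := coinWindow_finite k hWfin
  set K : Finset Coin := hCWfin.toFinset with hK
  have hKc : (↑K : Set Coin) = coinWindow k W := Set.Finite.coe_toFinset _
  -- `cfg ⁻¹' X` is determined by `K`
  have hXd : DeterminedBy ((cfg k) ⁻¹' X) (↑K : Set Coin) := by
    rw [hKc]
    exact determinedBy_preimage_cfg k (determinedBy_sixArmThreeClustersAt (ctr k u) r R')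
  -- `cfg ⁻¹' Y` is determined by `Kᶜ`
  have hYd : DeterminedBy ((cfg k) ⁻¹' Y) (↑K : Set Coin)ᶜ := by
    refine (determinedBy_preimage_cfg k (determinedBy_Rel_compl k m F η u R)).mono ?_
    rw [hKc]
    intro i hi hiK
    obtain ⟨vd', hvd', hi'⟩ := Set.mem_iUnion₂.1 hi
    obtain ⟨vd, hvd, hiv⟩ := Set.mem_iUnion₂.1 hiK
    have hin : ∀ w ∈ edgeOf vd, w - ctr k u ∈ box 2 R' := sub_mem_box_of_mem_sym2_annulus hvd
    exact Set.disjoint_left.1 (disjoint_coinsOf_of_far hk hR hin hvd') hiv hi'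
  exact prodBernoulli_real_inter_of_determinedBy _ K hXd hYd ((measurable_cfg k) hXm)
    ((measurable_cfg k) hYm)

/-- **FAR-FIELD FACTORISATION OF THE SIX-ARM SECTOR TERM** (registered helper of
`stub_sixArmSectorMass`).  For `η ≠ 0`, `0 < k`, `k + 1 ≤ R'` and `R' + k ≤ R`:
`Six k m F η q u R ≤ M_k(q)(sixArmThreeClustersAt (k•u) (k+1) R') · M_k(q)(Rel k m F η u R)` —
shrink the six-arm annulus to the `R'`-box (monotonicity on lattice configurations, which carry
`M_k`), then use the independence of the inside of the `R'`-box and the outside of the `R`-box. -/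
theorem Six_le_real_sixArm_mul_real_Rel {k : ℕ} (hk : 0 < k) (m : ℕ) (F : Fin m → Quad (univ : Set ℂ))
    {η : ℝ} (hη : η ≠ 0) (q : ℝ × ℝ) (u : Site 2) {R' R : ℕ} (hR' : k + 1 ≤ R') (hR : R' + k ≤ R) :
    Six k m F η q u R ≤
      (M k q.1 q.2).real (sixArmThreeClustersAt (ctr k u) (k + 1) R') *
        (M k q.1 q.2).real (Rel k m F η u R) := by
  rw [← real_sixArmThreeClustersAt_inter_Rel_eq_mul hk m F hη q u (k + 1) hR]
  unfold Six
  refine ENNReal.toReal_mono (measure_ne_top _ _) (measure_mono_ae ?_)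
  have hae : ∀ᵐ ω ∂(M k q.1 q.2), ω ⊆ (zdGraph 2).edgeSet :=
    selfRefinementMeasure_ae_subset_edgeSet k q.1 q.2
  filter_upwards [hae] with ω hω h
  exact ⟨mem_sixArmThreeClustersAt_mono le_rfl hR' (by omega) hω h.1, h.2⟩

end Summit.CriticalPhenomena.CardyFormulaZ2.Theorems.CardySelfRefinement.FarField

end
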